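import Summits.QuantumFields.YangMills.Theorems.LangevinControlUVFemtoCurvatureTwoPointCSmallTorusVariance
import Summits.QuantumFields.YangMills.Theorems.LangevinControlUVFemtoCurvatureTwoPointAxisProfileAntitone
import Summits.QuantumFields.YangMills.Theorems.LangevinControlUVFemtoCurvatureTwoPointCSplitBridge
import HarnessLib

/-!
# Route `LangevinControlUV`, crux `FemtoCurvatureTwoPointC` (stmt-QuantumFields-16204): line `conditional-covariance-floor`,
# the bridge for stub Bnd — bounded boxes ⟸ R-diagonal on the sub-box `8n` + a `u`-free nearest-neighbour floor

The skeleton `Cruxes/FemtoCurvatureTwoPointC/Lines/conditional_covariance_floor.lean` has the stub `stub_boundedBoxes` (Bnd): for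
EVERY box coupling `u` carrying the R-bundle (admissibility, bare size, comparability, dyadic step law, DIAGONAL two-sided matching
`c·u(L,β)² ≤ ⌊L/8⌋⁸·Cov_{L,β}(P_0^{01}, P_{⌊L/8⌋e₂}^{01}) ≤ C·u(L,β)²` on window boxes) and every bound `L₀`, the transverse LOWER
matching `c₀·u(8n,β)² ≤ n⁸·Cov_{L,β}(P_0^{01}, P_{ne₂}^{01})` for `1 ≤ n`, `8n ≤ L ≤ L₀` beyond a threshold. This file proves,
sorry-free, the BRIDGE reducing Bnd to ONE `u`-free fixed-torus statement, the nearest-neighbour floor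

  NN : `∀ L₀, ∃ β₂ c₁ > 0, ∀ 8 ≤ L ≤ L₀, ∀ β ≥ β₂, c₁/β² ≤ Cov_{L,β}(P_0^{01}, P_{e₂}^{01})`

(second-order Laplace asymptotics of Wilson's measure on finitely many fixed tori; NOT proved here).

Proof of `boundedBoxes_of_nearestNeighbourFloor` (everything used is landed):

* the elementary doubling chain `stub_expCommutatorBracket` + `stub_koszulH1` + `stub_haarCoLipschitz` ⇒ `stub_sublevelDoubling` ⇒
  `stub_secondMomentOfDoubling` gives, on EVERY fixed torus, `⟨S²⟩_{L,β} ≤ K'_L/β²` eventually; hence (`0 ≤ P_0^{01} ≤ S` pointwise,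
  `Var ≤ ⟨P²⟩`) `Var_{L,β}(P_0^{01}) ≤ K/β²` with ONE `K`, ONE threshold for all `L ≤ L₀` (`var_ceiling_upTo`, finite sums over
  `Finset.range (L₀+1)`);
* reflection positivity: the axis profile `f(s) = Cov_{L,β}(P_0^{01}, P_{se₂}^{01})` is `≥ 0` (`axisPlaquetteCov_nonneg`) and log-convex,
  `f(s)² ≤ f(s−1)·f(s+1)` for `1 ≤ s ≤ L − 1` (`axisProfile_logConvex`, transported to the crux's `e₂`-form by `cruxAxisCov_eq`), so
  `f(n) ≥ f(1)·(f(1)/A)^{n−1}` whenever `f(0) ≤ A` (`geometric_lower`, pure real arithmetic); with `f(1) ≥ c₁/β²` (NN) and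
  `A = K/β²` this is `f(n) ≥ (c₁/β²)·(c₁/K)^{n−1}` — a `β`-INDEPENDENT geometric ratio;
* R's LOWER diagonal matching on the sub-box `8n` (a window box, `⌊8n/8⌋ = n`) and the Cauchy–Schwarz ceiling `|Cov| ≤ Var`
  (`abs_cov_le_var_PE`) give `c·u(8n,β)² ≤ n⁸·Cov_{8n,β}(n) ≤ n⁸·K/β²`;
* combine with `c₀ := c·(c₁/K)^{L₀}` (`K := max K c₁`, so the ratio is in `(0,1]` and `(c₁/K)^{L₀} ≤ (c₁/K)^n` for `n ≤ L₀`),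
  threshold `max (max β₀ β₂) B`.

Design. Hypothesis (1) is CHARACTER FOR CHARACTER the antecedent of the registered `stub_boundedBoxes`, the conclusion is character for
character its consequent; hypothesis (2) is NN in the stub's `P`/`E` style. Nothing here is physics and nothing is asserted
unconditionally. Deliberately NOT here: NN itself, R, and the other stubs of the line.
-/

set_option autoImplicit false

noncomputable section

open MeasureTheory
open Literature.MathematicalPhysics.QuantumFieldTheory
open Summit.QuantumFields.YangMills.Theorems.FemtoCurvatureTwoPoint.PlaquetteVariance
open Summit.QuantumFields.YangMills.Theorems.FemtoCurvatureTwoPoint.AxisCovNonneg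

namespace Summit.QuantumFields.YangMills.Theorems.FemtoCurvatureTwoPointC

/-! ## Pure real arithmetic: a log-convex non-negative profile decays at most geometrically -/

/-- **Geometric lower bound from log-convexity (pure real arithmetic).** If `f ≥ 0`, `f(m)² ≤ f(m−1)·f(m+1)` for
`1 ≤ m ≤ L − 1`, `f(0) ≤ A` and `0 < a ≤ f(1)` (`0 < A`), then `a·(a/A)^{n−1} ≤ f(n)` for `1 ≤ n ≤ L − 1`: the ratios
`f(m+1)/f(m)` are non-decreasing, so each is at least `f(1)/f(0) ≥ a/A`. [folklore] -/
theorem geometric_lower {f : ℕ → ℝ} {L : ℕ} {a A : ℝ} (ha : 0 < a) (hA : 0 < A)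
    (hnn : ∀ s, 0 ≤ f s) (hlc : ∀ m, 1 ≤ m → m + 1 ≤ L → f m ^ 2 ≤ f (m - 1) * f (m + 1))
    (h0 : f 0 ≤ A) (h1 : a ≤ f 1) :
    ∀ n, 1 ≤ n → n + 1 ≤ L → a * (a / A) ^ (n - 1) ≤ f n := by
  set q : ℝ := a / A with hq
  have hq0 : 0 < q := div_pos ha hA
  -- one step: `q · f(m-1) ≤ f(m)` and `0 < f(m)` for `1 ≤ m ≤ L - 1`
  have hstep : ∀ m, 1 ≤ m → m + 1 ≤ L → q * f (m - 1) ≤ f m ∧ 0 < f m := by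
    intro m hm
    induction m, hm using Nat.le_induction with
    | base =>
      intro _
      refine ⟨?_, lt_of_lt_of_le ha h1⟩
      calc q * f (1 - 1) = q * f 0 := by rfl
        _ ≤ q * A := mul_le_mul_of_nonneg_left h0 hq0.le
        _ = a := by rw [hq]; field_simp
        _ ≤ f 1 := h1
    | succ m hm ih =>
      intro hmL
      obtain ⟨ihq, ihpos⟩ := ih (by omega)
      have hl := hlc m hm (by omega)
      have h2 : q * f m ^ 2 ≤ f m * f (m + 1) :=
        calc q * f m ^ 2 ≤ q * (f (m - 1) * f (m + 1)) := mul_le_mul_of_nonneg_left hl hq0.le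
          _ = (q * f (m - 1)) * f (m + 1) := by ring
          _ ≤ f m * f (m + 1) := mul_le_mul_of_nonneg_right ihq (hnn _)
      have h3 : f m * (q * f m) ≤ f m * f (m + 1) := by nlinarith [h2]
      have key : q * f m ≤ f (m + 1) := le_of_mul_le_mul_left h3 ihpos
      refine ⟨?_, lt_of_lt_of_le (mul_pos hq0 ihpos) key⟩
      simpa only [Nat.add_sub_cancel] using key
  intro n hn
  induction n, hn using Nat.le_induction with
  | base =>
    intro _
    simpa using h1
  | succ n hn ih =>
    intro hnL
    have ih' := ih (by omega)
    obtain ⟨hqn, -⟩ := hstep (n + 1) (by omega) hnL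
    simp only [Nat.add_sub_cancel] at hqn ⊢
    obtain ⟨k, rfl⟩ : ∃ k, n = k + 1 := ⟨n - 1, by omega⟩
    simp only [Nat.add_sub_cancel] at ih'
    calc a * q ^ (k + 1) = q * (a * q ^ k) := by ring
      _ ≤ q * f (k + 1) := mul_le_mul_of_nonneg_left ih' hq0.le
      _ ≤ f (k + 1 + 1) := hqn

/-! ## Per-torus facts in the crux's `P`/`E` vocabulary -/

section PerTorus

variable {G : Type} [Group G] [TopologicalSpace G] [IsTopologicalGroup G] [CompactSpace G]
  [MeasurableSpace G] [BorelSpace G]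

/-- **Log-convexity of the crux's axis profile, `P`/`E` form.** For a lattice representation `r`, `β ≥ 0` and
`1 ≤ m ≤ L − 1`: `f(m)² ≤ f(m−1)·f(m+1)` for `f(s) = Cov_{L,β}(P_0^{01}, P_{se₂}^{01})` — the landed reflection-positivity
Cauchy–Schwarz `AxisCovNonneg.axisProfile_logConvex` on the time axis, transported by the coordinate permutation
`AxisCovNonneg.cruxAxisCov_eq`. [folklore] -/
theorem axisCov_logConvex_PE (r : LatticeRep G) {L : ℕ} [NeZero L] {β : ℝ} (hβ : 0 ≤ β)
    (P : (Fin 4 → ZMod L) → Fin 4 → Fin 4 → GaugeConfig 4 L G → ℝ) (E : (GaugeConfig 4 L G → ℝ) → ℝ)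
    (hP : P = fun x i j U => (r.N : ℝ) - (r.ρ (plaquetteHolonomy U x i j)).trace.re)
    (hE : E = fun F => wilsonExpectation r.ρ β F) {m : ℕ} (hm : 1 ≤ m) (hmL : m + 1 ≤ L) :
    (E (fun U => P 0 0 1 U * P (Pi.single (2 : Fin 4) ((m : ℕ) : ZMod L)) 0 1 U)
        - E (P 0 0 1) * E (P (Pi.single (2 : Fin 4) ((m : ℕ) : ZMod L)) 0 1)) ^ 2 ≤
      (E (fun U => P 0 0 1 U * P (Pi.single (2 : Fin 4) (((m - 1 : ℕ) : ℕ) : ZMod L)) 0 1 U)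
        - E (P 0 0 1) * E (P (Pi.single (2 : Fin 4) (((m - 1 : ℕ) : ℕ) : ZMod L)) 0 1)) *
      (E (fun U => P 0 0 1 U * P (Pi.single (2 : Fin 4) (((m + 1 : ℕ) : ℕ) : ZMod L)) 0 1 U)
        - E (P 0 0 1) * E (P (Pi.single (2 : Fin 4) (((m + 1 : ℕ) : ℕ) : ZMod L)) 0 1)) := by
  subst hP hE
  dsimp only
  rw [cruxAxisCov_eq r.ρ r.continuous β m, cruxAxisCov_eq r.ρ r.continuous β (m - 1),
    cruxAxisCov_eq r.ρ r.continuous β (m + 1)]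
  exact axisProfile_logConvex (L := L) (d := 3) r.ρ r.continuous hβ _ (by decide) _ rfl hm hmL

/-- **Geometric lower bound for the crux's axis profile, `P`/`E` form.** For a lattice representation `r`, `β ≥ 0`:
if `Var_{L,β}(P_0^{01}) ≤ A` and `0 < a ≤ Cov_{L,β}(P_0^{01}, P_{e₂}^{01})` (`0 < A`), then
`a·(a/A)^{n−1} ≤ Cov_{L,β}(P_0^{01}, P_{ne₂}^{01})` for `1 ≤ n ≤ L − 1` (log-convexity + `Cov ≥ 0`, both by reflection
positivity, and `|Cov| ≤ Var`). [folklore] -/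
theorem axisCov_geometric_lower_PE (r : LatticeRep G) {L : ℕ} [NeZero L] {β : ℝ} (hβ : 0 ≤ β)
    (P : (Fin 4 → ZMod L) → Fin 4 → Fin 4 → GaugeConfig 4 L G → ℝ) (E : (GaugeConfig 4 L G → ℝ) → ℝ)
    (hP : P = fun x i j U => (r.N : ℝ) - (r.ρ (plaquetteHolonomy U x i j)).trace.re)
    (hE : E = fun F => wilsonExpectation r.ρ β F) {a A : ℝ} (ha : 0 < a) (hA : 0 < A)
    (h0 : E (fun U => P 0 0 1 U * P 0 0 1 U) - E (P 0 0 1) * E (P 0 0 1) ≤ A)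
    (h1 : a ≤ E (fun U => P 0 0 1 U * P (Pi.single (2 : Fin 4) ((1 : ℕ) : ZMod L)) 0 1 U)
        - E (P 0 0 1) * E (P (Pi.single (2 : Fin 4) ((1 : ℕ) : ZMod L)) 0 1))
    {n : ℕ} (hn : 1 ≤ n) (hnL : n + 1 ≤ L) :
    a * (a / A) ^ (n - 1) ≤
      E (fun U => P 0 0 1 U * P (Pi.single (2 : Fin 4) ((n : ℕ) : ZMod L)) 0 1 U)
        - E (P 0 0 1) * E (P (Pi.single (2 : Fin 4) ((n : ℕ) : ZMod L)) 0 1) := by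
  set f : ℕ → ℝ := fun s => E (fun U => P 0 0 1 U * P (Pi.single (2 : Fin 4) ((s : ℕ) : ZMod L)) 0 1 U)
    - E (P 0 0 1) * E (P (Pi.single (2 : Fin 4) ((s : ℕ) : ZMod L)) 0 1) with hf
  have hnn : ∀ s, 0 ≤ f s := fun s => by
    simp only [hf, hP, hE]
    exact axisPlaquetteCov_nonneg r.ρ r.continuous hβ s
  have hlc : ∀ m, 1 ≤ m → m + 1 ≤ L → f m ^ 2 ≤ f (m - 1) * f (m + 1) := fun m hm hmL =>
    axisCov_logConvex_PE r hβ P E hP hE hm hmL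
  have h0' : f 0 ≤ A := by
    have habs := abs_cov_le_var_PE r β P E hP hE 0 (Pi.single (2 : Fin 4) (((0 : ℕ) : ℕ) : ZMod L)) 0 1 0 1
    exact (le_abs_self _).trans (habs.trans h0)
  exact geometric_lower ha hA hnn hlc h0' h1 n hn hnL

/-- **One variance ceiling on all tori `L ≤ L₀` (from the landed doubling chain).** For a lattice representation `r` and a
bound `L₀` there are `K ≥ 0` and a threshold `B ≥ 1` with `Var_{L,β}(P_0^{01}) ≤ K/β²` for every `L ≤ L₀` and `β ≥ B`:
per torus, `stub_sublevelDoubling` (fed by `stub_expCommutatorBracket`, `stub_koszulH1`, `stub_haarCoLipschitz`) ⇒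
`stub_secondMomentOfDoubling` ⇒ `⟨S²⟩ ≤ K'_L/β²`, then `Var ≤ ⟨P²⟩ ≤ ⟨S²⟩` (`0 ≤ P ≤ S`); `K := ∑_{m ≤ L₀} |K'_m|`,
`B := 1 + ∑_{m ≤ L₀} |B_m|`. [folklore] -/
theorem var_ceiling_upTo (r : LatticeRep G) (L₀ : ℕ) :
    ∃ (K B : ℝ), 0 ≤ K ∧ 1 ≤ B ∧ ∀ (L : ℕ) [NeZero L] (β : ℝ), L ≤ L₀ → B ≤ β →
      ∀ (P : (Fin 4 → ZMod L) → Fin 4 → Fin 4 → GaugeConfig 4 L G → ℝ) (E : (GaugeConfig 4 L G → ℝ) → ℝ),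
        (P = fun x i j U => (r.N : ℝ) - (r.ρ (plaquetteHolonomy U x i j)).trace.re) →
        (E = fun F => wilsonExpectation r.ρ β F) →
        E (fun U => P 0 0 1 U * P 0 0 1 U) - E (P 0 0 1) * E (P 0 0 1) ≤ K / β ^ 2 := by
  -- the second-moment law on every torus (junk witnesses at `L = 0`)
  have hS' : ∀ L : ℕ, ∃ (K' B : ℝ), ∀ β : ℝ, B ≤ β → ∀ [NeZero L],
      wilsonExpectation r.ρ β (fun U : GaugeConfig 4 L G => wilsonAction r.ρ U ^ 2) ≤ K' / β ^ 2 := by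
    intro L
    by_cases hL0 : L = 0
    · refine ⟨0, 0, fun β _ => ?_⟩
      intro _
      exact absurd hL0 (NeZero.ne L)
    · haveI : NeZero L := ⟨hL0⟩
      obtain ⟨K', B, hKB⟩ := stub_secondMomentOfDoubling G r L
        (stub_sublevelDoubling stub_expCommutatorBracket stub_koszulH1 stub_haarCoLipschitz G r L)
      refine ⟨K', B, fun β hβ => ?_⟩
      intro _
      exact hKB β hβ
  choose K' B hKB using hS'
  have hKnn : 0 ≤ ∑ m ∈ Finset.range (L₀ + 1), |K' m| := Finset.sum_nonneg fun m _ => abs_nonneg (K' m)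
  have hBnn : 0 ≤ ∑ m ∈ Finset.range (L₀ + 1), |B m| := Finset.sum_nonneg fun m _ => abs_nonneg (B m)
  refine ⟨∑ m ∈ Finset.range (L₀ + 1), |K' m|, 1 + ∑ m ∈ Finset.range (L₀ + 1), |B m|, hKnn, by linarith, ?_⟩
  intro L iL β hL hβ P E hP hE
  subst hP hE
  dsimp only
  have hLr : L ∈ Finset.range (L₀ + 1) := Finset.mem_range.2 (Nat.lt_succ_of_le hL)
  -- thresholds: `B L ≤ β` and `0 < β`
  have hBL : B L ≤ β := by
    have h1 : |B L| ≤ ∑ m ∈ Finset.range (L₀ + 1), |B m| :=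
      Finset.single_le_sum (f := fun m => |B m|) (fun m _ => abs_nonneg (B m)) hLr
    linarith [le_abs_self (B L)]
  have hβ0 : 0 < β := by linarith
  -- the constant: `K' L ≤ ∑ |K' m|`
  have hKL : K' L ≤ ∑ m ∈ Finset.range (L₀ + 1), |K' m| := by
    have h1 : |K' L| ≤ ∑ m ∈ Finset.range (L₀ + 1), |K' m| :=
      Finset.single_le_sum (f := fun m => |K' m|) (fun m _ => abs_nonneg (K' m)) hLr
    exact (le_abs_self (K' L)).trans h1
  -- (i) `Var P ≤ |Var P| ≤ ⟨P²⟩`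
  have hXm := measurable_plaq01 r.ρ r.continuous (0 : Site 4 L)
  have hXb : ∀ U : GaugeConfig 4 L G,
      |(r.N : ℝ) - (r.ρ (plaquetteHolonomy U 0 0 1)).trace.re| ≤ 2 * r.N := fun U => by
    obtain ⟨h0, h2⟩ := plaqField_mem r.ρ r.continuous (plaquetteHolonomy U 0 0 1)
    rw [abs_of_nonneg h0]
    exact h2
  have hvar := abs_var_le_wilsonExpectation_sq r.ρ r.continuous β hXm hXb
  -- (ii) `⟨P²⟩ ≤ ⟨S²⟩`
  have hsq := wilsonExpectation_plaq01_sq_le_wilsonAction_sq (L := L) r.ρ r.continuous β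
  -- (iii) `⟨S²⟩ ≤ K' L / β² ≤ K / β²`
  have hmom : wilsonExpectation r.ρ β (fun U : GaugeConfig 4 L G => wilsonAction r.ρ U ^ 2) ≤
      K' L / β ^ 2 := hKB L β hBL
  have hK : K' L / β ^ 2 ≤ (∑ m ∈ Finset.range (L₀ + 1), |K' m|) / β ^ 2 :=
    div_le_div_of_nonneg_right hKL (by positivity)
  exact (le_abs_self _).trans (hvar.trans (hsq.trans (hmom.trans hK)))

end PerTorus

/-! ## The bridge -/

/-- **Bnd ⟸ R-diagonal on the sub-box `8n` + nearest-neighbour floor (line `conditional-covariance-floor`, sorry-free bridge).**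
For a compact group `G`, a lattice representation `r` and a GIVEN box coupling `u : ℕ → ℝ → ℝ` with constants
`u₀ β₀ κ₁ κ₂ κ₃ c C c₈` carrying the R-bundle (hypothesis 1, verbatim the antecedent of the registered `stub_boundedBoxes`:
admissibility, continuity, freezing, bare size, in-window comparability, dyadic AF step law, DIAGONAL two-sided matching on
window boxes), the `u`-free fixed-torus NEAREST-NEIGHBOUR FLOOR (hypothesis 2, NN: for every `L₀` there are `β₂`, `c₁ > 0` with
`c₁/β² ≤ Cov_{L,β}(P_0^{01}, P_{e₂}^{01})` for `8 ≤ L ≤ L₀`, `β ≥ β₂`) implies Bnd's conclusion verbatim: for every `L₀` there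
are `β₁`, `c₀ > 0` with `c₀·u(8n,β)² ≤ n⁸·Cov_{L,β}(P_0^{01}, P_{ne₂}^{01})` for `β ≥ β₁`, `L ≤ L₀`, `1 ≤ n`, `8n ≤ L` on window
boxes. Route: ONE variance ceiling `Var_{L,β} ≤ K/β²` on all `L ≤ L₀` (landed doubling chain, `var_ceiling_upTo`); log-convexity
+ positivity of the axis profile (reflection positivity) ⇒ `Cov_{L,β}(n) ≥ (c₁/β²)(c₁/K)^{n−1}`; R's lower diagonal matching on the
window sub-box `8n` + `|Cov| ≤ Var` ⇒ `c·u(8n,β)² ≤ n⁸K/β²`. Witnesses: `β₁ = max (max β₀ β₂) B`, `c₀ = c·(c₁/max K c₁)^{L₀}`.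
Only the positivity of `c` and the lower diagonal clause of the R-bundle are used. Use as
`boundedBoxes_of_nearestNeighbourFloor r u u₀ β₀ κ₁ κ₂ κ₃ c C c₈ hR hNN`. [folklore] -/
theorem boundedBoxes_of_nearestNeighbourFloor :
    ∀ {G : Type} [Group G] [TopologicalSpace G] [IsTopologicalGroup G] [CompactSpace G]
        [MeasurableSpace G] [BorelSpace G] (r : LatticeRep G) (u : ℕ → ℝ → ℝ) (u₀ β₀ κ₁ κ₂ κ₃ c C c₈ : ℝ),
      (0 < u₀ ∧ 0 < c ∧ 0 < κ₁ ∧ 0 ≤ κ₃ ∧ 0 < c₈ ∧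
        (∀ (L : ℕ) (β : ℝ), 8 ≤ L → β₀ ≤ β → 0 < u L β) ∧
        (∀ L : ℕ, 8 ≤ L → ContinuousOn (u L) (Set.Ici β₀)) ∧
        (∀ L : ℕ, 8 ≤ L → Filter.Tendsto (u L) Filter.atTop (nhds 0)) ∧
        (∀ β : ℝ, β₀ ≤ β → c₈ ≤ β * u 8 β) ∧
        (∀ (L L' : ℕ) (β : ℝ), β₀ ≤ β → 8 ≤ L → L ≤ L' → L' ≤ 2 * L →
            (∀ M : ℕ, 8 ≤ M → M ≤ L → u M β ≤ u₀) → |(u L β)⁻¹ - (u L' β)⁻¹| ≤ κ₂) ∧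
        (∀ (k m : ℕ) (β : ℝ), β₀ ≤ β → (∀ M : ℕ, 8 ≤ M → M ≤ 8 * 2 ^ (k + m) → u M β ≤ u₀) →
            κ₁ * m - κ₃ ≤ (u (8 * 2 ^ k) β)⁻¹ - (u (8 * 2 ^ (k + m)) β)⁻¹ ∧
              (u (8 * 2 ^ k) β)⁻¹ - (u (8 * 2 ^ (k + m)) β)⁻¹ ≤ κ₂ * m + κ₃) ∧
        (∀ (L : ℕ) [NeZero L] (β : ℝ), β₀ ≤ β → 8 ≤ L →
            (∀ M : ℕ, 8 ≤ M → M ≤ L → u M β ≤ u₀) →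
            ∀ (P : (Fin 4 → ZMod L) → Fin 4 → Fin 4 → GaugeConfig 4 L G → ℝ)
              (E : (GaugeConfig 4 L G → ℝ) → ℝ),
              (P = fun x i j U => (r.N : ℝ) - (r.ρ (plaquetteHolonomy U x i j)).trace.re) →
              (E = fun F => wilsonExpectation r.ρ β F) →
              c * u L β ^ 2 ≤
                ((L / 8 : ℕ) : ℝ) ^ 8 * (E (fun U => P 0 0 1 U * P (Pi.single (2 : Fin 4) ((L / 8 : ℕ) : ZMod L)) 0 1 U)
                  - E (P 0 0 1) * E (P (Pi.single (2 : Fin 4) ((L / 8 : ℕ) : ZMod L)) 0 1)) ∧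
              ((L / 8 : ℕ) : ℝ) ^ 8 * (E (fun U => P 0 0 1 U * P (Pi.single (2 : Fin 4) ((L / 8 : ℕ) : ZMod L)) 0 1 U)
                - E (P 0 0 1) * E (P (Pi.single (2 : Fin 4) ((L / 8 : ℕ) : ZMod L)) 0 1)) ≤ C * u L β ^ 2)) →
      (∀ L₀ : ℕ, ∃ (β₂ c₁ : ℝ), 0 < c₁ ∧
        ∀ (L : ℕ) [NeZero L] (β : ℝ), 8 ≤ L → L ≤ L₀ → β₂ ≤ β →
          ∀ (P : (Fin 4 → ZMod L) → Fin 4 → Fin 4 → GaugeConfig 4 L G → ℝ)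
            (E : (GaugeConfig 4 L G → ℝ) → ℝ),
            (P = fun x i j U => (r.N : ℝ) - (r.ρ (plaquetteHolonomy U x i j)).trace.re) →
            (E = fun F => wilsonExpectation r.ρ β F) →
            c₁ / β ^ 2 ≤
              E (fun U => P 0 0 1 U * P (Pi.single (2 : Fin 4) ((1 : ℕ) : ZMod L)) 0 1 U)
                - E (P 0 0 1) * E (P (Pi.single (2 : Fin 4) ((1 : ℕ) : ZMod L)) 0 1)) →
      ∀ L₀ : ℕ, ∃ (β₁ c₀ : ℝ), 0 < c₀ ∧
        (∀ (L : ℕ) [NeZero L] (β : ℝ) (n : ℕ), β₁ ≤ β → L ≤ L₀ → 1 ≤ n → 8 * n ≤ L →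
            (∀ M : ℕ, 8 ≤ M → M ≤ L → u M β ≤ u₀) →
            ∀ (P : (Fin 4 → ZMod L) → Fin 4 → Fin 4 → GaugeConfig 4 L G → ℝ)
              (E : (GaugeConfig 4 L G → ℝ) → ℝ),
              (P = fun x i j U => (r.N : ℝ) - (r.ρ (plaquetteHolonomy U x i j)).trace.re) →
              (E = fun F => wilsonExpectation r.ρ β F) →
              c₀ * u (8 * n) β ^ 2 ≤
                (n : ℝ) ^ 8 * (E (fun U => P 0 0 1 U * P (Pi.single (2 : Fin 4) ((n : ℕ) : ZMod L)) 0 1 U)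
                      - E (P 0 0 1) * E (P (Pi.single (2 : Fin 4) ((n : ℕ) : ZMod L)) 0 1))) := by
  intro G _ _ _ _ _ _ r u u₀ β₀ κ₁ κ₂ κ₃ c C c₈ hR hNN L₀
  obtain ⟨-, hc, -, -, -, -, -, -, -, -, -, hdiag⟩ := hR
  obtain ⟨β₂, c₁, hc₁, hnn⟩ := hNN L₀
  obtain ⟨K, B, hK0, hB1, hvar⟩ := var_ceiling_upTo r L₀
  -- constants: `Kp := max K c₁ ≥ c₁ > 0`, ratio `q := c₁ / Kp ∈ (0, 1]`
  set Kp : ℝ := max K c₁ with hKp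
  have hKKp : K ≤ Kp := le_max_left _ _
  have hKp0 : 0 < Kp := lt_of_lt_of_le hc₁ (le_max_right _ _)
  set q : ℝ := c₁ / Kp with hq
  have hq0 : 0 < q := div_pos hc₁ hKp0
  have hq1 : q ≤ 1 := (div_le_one hKp0).2 (le_max_right _ _)
  refine ⟨max (max β₀ β₂) B, c * q ^ L₀, mul_pos hc (pow_pos hq0 L₀), ?_⟩
  intro L _ β n hβ hL₀ hn hnL hwin P E hP hE
  -- thresholds
  have hβ₀ : β₀ ≤ β := ((le_max_left _ _).trans (le_max_left _ _)).trans hβ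
  have hβ₂ : β₂ ≤ β := ((le_max_right _ _).trans (le_max_left _ _)).trans hβ
  have hB : B ≤ β := (le_max_right _ _).trans hβ
  have hβpos : 0 < β := lt_of_lt_of_le one_pos (hB1.trans hB)
  have hβnn : 0 ≤ β := hβpos.le
  have h8L : 8 ≤ L := by omega
  have hnL₀ : n ≤ L₀ := by omega
  -- (i) on the box `L`: `Var ≤ Kp/β²`, `f(1) ≥ c₁/β²`, hence `f(n) ≥ (c₁/β²)·q^(n-1)`
  have hV : E (fun U => P 0 0 1 U * P 0 0 1 U) - E (P 0 0 1) * E (P 0 0 1) ≤ Kp / β ^ 2 :=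
    (hvar L β hL₀ hB P E hP hE).trans (div_le_div_of_nonneg_right hKKp (by positivity))
  have h1 := hnn L β h8L hL₀ hβ₂ P E hP hE
  have hgeo := axisCov_geometric_lower_PE r hβnn P E hP hE (a := c₁ / β ^ 2) (A := Kp / β ^ 2)
    (by positivity) (by positivity) hV h1 hn (by omega)
  have hratio : c₁ / β ^ 2 / (Kp / β ^ 2) = q := by
    rw [hq]; field_simp
  rw [hratio] at hgeo
  -- (ii) on the window sub-box `8n`: `c·u(8n,β)² ≤ n⁸·Cov_{8n,β}(n) ≤ n⁸·Var_{8n,β} ≤ n⁸·Kp/β²`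
  haveI : NeZero (8 * n) := ⟨by omega⟩
  have hwin' : ∀ M : ℕ, 8 ≤ M → M ≤ 8 * n → u M β ≤ u₀ := fun M hM hMle => hwin M hM (hMle.trans hnL)
  set P' : (Fin 4 → ZMod (8 * n)) → Fin 4 → Fin 4 → GaugeConfig 4 (8 * n) G → ℝ :=
    fun x i j U => (r.N : ℝ) - (r.ρ (plaquetteHolonomy U x i j)).trace.re with hP'
  set E' : (GaugeConfig 4 (8 * n) G → ℝ) → ℝ := fun F => wilsonExpectation r.ρ β F with hE'
  obtain ⟨hlo, -⟩ := hdiag (8 * n) β hβ₀ (by omega) hwin' P' E' hP' hE'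
  have e : 8 * n / 8 = n := by omega
  rw [e] at hlo
  have hcv := abs_cov_le_var_PE r β P' E' hP' hE' 0 (Pi.single (2 : Fin 4) ((n : ℕ) : ZMod (8 * n))) 0 1 0 1
  have hV' : E' (fun U => P' 0 0 1 U * P' 0 0 1 U) - E' (P' 0 0 1) * E' (P' 0 0 1) ≤ Kp / β ^ 2 :=
    (hvar (8 * n) β (hnL.trans hL₀) hB P' E' hP' hE').trans (div_le_div_of_nonneg_right hKKp (by positivity))
  have hu : c * u (8 * n) β ^ 2 ≤ (n : ℝ) ^ 8 * (Kp / β ^ 2) :=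
    hlo.trans (mul_le_mul_of_nonneg_left ((le_abs_self _).trans (hcv.trans hV')) (by positivity))
  -- (iii) combine: `c·q^{L₀}·u² ≤ q^n·(c·u²) ≤ q^n·n⁸·Kp/β² = n⁸·(c₁/β²)·q^(n-1) ≤ n⁸·f(n)`
  have hqn : q ^ L₀ ≤ q ^ n := pow_le_pow_of_le_one hq0.le hq1 hnL₀
  have hu2 : 0 ≤ u (8 * n) β ^ 2 := sq_nonneg _
  obtain ⟨k, rfl⟩ : ∃ k, n = k + 1 := ⟨n - 1, by omega⟩
  simp only [Nat.add_sub_cancel] at hgeo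
  have hqK : q * Kp = c₁ := by rw [hq]; field_simp
  calc c * q ^ L₀ * u (8 * (k + 1)) β ^ 2
      ≤ c * q ^ (k + 1) * u (8 * (k + 1)) β ^ 2 :=
        mul_le_mul_of_nonneg_right (mul_le_mul_of_nonneg_left hqn hc.le) hu2
    _ = q ^ (k + 1) * (c * u (8 * (k + 1)) β ^ 2) := by ring
    _ ≤ q ^ (k + 1) * (((k + 1 : ℕ) : ℝ) ^ 8 * (Kp / β ^ 2)) :=
        mul_le_mul_of_nonneg_left hu (pow_nonneg hq0.le _)
    _ = ((k + 1 : ℕ) : ℝ) ^ 8 * (c₁ / β ^ 2 * q ^ k) := by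
        rw [pow_succ]
        have : q ^ k * q * (((k + 1 : ℕ) : ℝ) ^ 8 * (Kp / β ^ 2)) =
            ((k + 1 : ℕ) : ℝ) ^ 8 * ((q * Kp) / β ^ 2 * q ^ k) := by ring
        rw [this, hqK]
    _ ≤ ((k + 1 : ℕ) : ℝ) ^ 8 * (E (fun U => P 0 0 1 U * P (Pi.single (2 : Fin 4) (((k + 1 : ℕ) : ℕ) : ZMod L)) 0 1 U)
          - E (P 0 0 1) * E (P (Pi.single (2 : Fin 4) (((k + 1 : ℕ) : ℕ) : ZMod L)) 0 1)) :=
        mul_le_mul_of_nonneg_left hgeo (by positivity)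

end Summit.QuantumFields.YangMills.Theorems.FemtoCurvatureTwoPointC

end
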